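import Literature.MathematicalPhysics.QuantumFieldTheory.Balaban1983to89.Node00.SmallFieldChi29OfRecord
import Literature.MathematicalPhysics.QuantumFieldTheory.Balaban1983to89.BlockAveragingExpMeanLogContinuous
import Literature.MathematicalPhysics.QuantumFieldTheory.Balaban1983to89.LatticeWordStokes

/-!
# NODE N09 · THE GAUGE-FIXING TERM OF RECORD `GF_k = Σ_y Σ_{x ∈ B(y)∖y} [1 − Re tr U(y,x)]` IS CONTINUOUS ON THE ADMISSIBLE SET OF ITS FEDERBUSH CONTOUR AVERAGE
# (the `hGF` input of the (F1) induction step, FILE 2 ∕ FILE 3 of this seat, reduced to «the staircase families over the small-field domain are `δ_N`-admissible»)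

Cell `pub-ymgap` (YM-PLAN Track A), DAG node N09 [Balaban1987RG1] (= [I]); seat `pub-ymgap-dag-n09-w1` g5 (D-0149 width seat 1 of node N09), FILE 4; count-neutral helper
keyed to K1⁷ `StabilityBAtRecordR13SepCoPH` = stmt-QuantumFields-20542 (`--kind proof --supports … --as helper`).  HONEST FRAMING: kernel topology BY NAME over lit-balaban's
Federbush mean (`BlockAveragingFederbush`) and the two-level contour variables (`BlockAveragingTwoLevel`); NOTHING of Bałaban's analysis asserted; N09 NOT discharged; K0⁷∕K1⁷
NOT closed; counts unmoved (typed 28∕28 · discharged 5∕27); one finite 𝕋⁴ programme at fixed ε — R4 closes the conditional rung `BalabanLadder.UV` only; the Yang–Mills mass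
gap (Clay) is NOT proved by any of this; nothing continuum ∕ ℝ⁴ ∕ OS.

WHY.  FILES 2–3 (`…N09FibreIntegralContinuousOfChartRegularity`, `…N09RegularityTowerOfChartRegularity`) run the (F1) induction from A-FREE per-step chart regularity plus
ONE non-chart input per step: `hGF : ContinuousOn (gfOfRecord F N K k) (domAltOfRecord ν K k)` — continuity of the gauge-fixing term of (0.17)∕(0.19) on the small-field
domain.  `gfOfRecord` ([I] (0.19) p. 255: `Σ_y Σ_{x∈B(y), x≠y} [1 − Re tr U(y,x)]`) reads the AVERAGED CONTOUR VARIABLES (0.11) `U(y,x) = M({U(Γ)}_{Γ ∈ G(y,x)})` with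
Federbush's implicit mean `M` (0.10) — a PARTIAL object in print («defined on sets {U_j} … with sufficiently small diameters», p. 253), totalised in the tree by a branch
(`BlockAveragingTwoLevel.holTo`: the mean on ADMISSIBLE staircase families, the single staircase off them).  So `GF_k` is continuous exactly where it should be: on the
OPEN set of configurations all of whose staircase families `{U(Γ^σ_{y,x})}_σ`, `x ∈ B(y)`, are `δ_N`-admissible — there `U(y,x)` is Federbush's mean, a Lipschitz
(`continuousOn_fedSol`) function of the family, and the family is polynomial in `U`.  THIS FILE proves that, and hands `hGF` to the ONE geometric sentence it then
costs — «on `domAltOfRecord ν K k` every staircase family is `δ_N`-admissible» — AND PROVES THAT SENTENCE TOO (§5): the quotient `U(Γ^σ)U(Γ^{τ})⁻¹` of two staircase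
transporters is the holonomy of a CLOSED word of length `≤ d·L`, so ym3-torus's crude non-abelian Stokes bound `LatticeWordStokes.dist1_holAt_le` gives
`|U(Γ^σ)U(Γ^τ)⁻¹ − 1| ≤ ((d·L)²∕4)·ε₀ < δ_N` under the displayed numerics ([I] p. 253's «sufficiently small diameters»; the (0.11) twin of `small_of_plaqSmall` for (0.4)).

WHAT IS PROVED (theorems only; 0 def; 0 sorry; axioms standard).
* §1 FEDERBUSH'S MEAN IS CONTINUOUS ON ITS GUARD, `SU(N)`, every arity: `isOpen_fedGuard_SU`, ★ `continuousOn_fedMSU` (the `hcont` step of lit-balaban's `measurable_fedMSU`,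
  promoted to a theorem: on `{∀ i k, ‖U_i U_k* − 1‖ < δ_N}` the mean is `(fedSol (U_j U₀*))* U₀`, `fedSol` Lipschitz on small families).
* §2 THE GROUP-AVERAGE FACE: `adm_federbushSU_iff` (`Adm` IS the guard of the enumerated family, `rfl`), `isOpen_setOf_adm_federbushSU`, ★ `continuousOn_avg_federbushSU`
  (`W ↦ federbushSU.avg W` is continuous on `{W | federbushSU.Adm W}`).
* §3 THE CONTOUR FACE (`BlockAveragingTwoLevel`): `continuous_stairHol_SU` (the staircase family is continuous in `U`), `isOpen_setOf_adm_stairHol`,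
  ★ `continuousOn_holTo_federbushSU` (the averaged contour variable `U(y,x)` is continuous on `{U | Adm (stairHol U y (offsetOf y x))}`, where it IS the mean).
* §4 AT THE RECORD: `isOpen_admissibleSet`, ★★ `continuousOn_gfOfRecord_admissible` (`GF_k` continuous on `{U | ∀ y, ∀ x ∈ B(y), Adm (stairHol U y (offsetOf y x))}`),
  ★★ `continuousOn_gfOfRecord_of_subset_admissible` (hence on every subset — the `hGF` supplier), ★★ `continuousOn_gfOfRecord_domAlt_of_admissible` (at `domAltOfRecord ν K k`
  from the geometric inclusion as a hypothesis).
* §5 THE GEOMETRIC INCLUSION (lit-balaban ∕ ym3-torus `LatticeWordStokes` BY NAME): `stairHol_mul_inv_eq_holAt` (the quotient of two staircase transporters is the holonomy of a CLOSED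
  word), `netDisp_stairWord_append_wordRev`, `length_stairWord_append_wordRev_le`, ★ `dist1_stairHol_mul_inv_le` (`≤ ((d·L)²∕4)·a` on `a`-small fields, `dist1_holAt_le`),
  ★★ `adm_stairHol_of_plaqSmall` (every staircase family over `B(y)` is `δ_N`-admissible once `((d·L)²∕4)·a < δ_N`), ★★★ `continuousOn_gfOfRecord_domAlt`
  (`hGF` DISCHARGED modulo the numerics `0 ≤ ν.ε₀`, `((d·L)²∕4)·ν.ε₀ < δ_N` and the standing range).

HONEST SCOPE.  (i) The numerics `((d·L)²∕4)·ν.ε₀ < δ_N = min(1∕100, 1∕(3N))` (Federbush's radius) and `0 ≤ ν.ε₀` are DISPLAYED (K0-numerics' letters; at a witness with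
`ε₀ = 1` they FAIL — located, as for the (0.4) guard).  (ii) Off the admissible set nothing is claimed (the branch switch of the total `holTo` is a genuine discontinuity locus).
(iii) Nothing of lit-balaban ∕ ym3-torus re-proved: `continuousOn_fedSol`, `fedM_of_small`, `coe_fedMSU`, `holTo_of_adm`, `continuous_holAt`, `dist1_holAt_le`,
`length_stairWord_le` consumed BY NAME.
-/

noncomputable section

open Set Filter Topology
open scoped Matrix.Norms.L2Operator
open Literature.MathematicalPhysics.QuantumFieldTheory
open Literature.MathematicalPhysics.QuantumFieldTheory.Balaban1983to89
open Literature.MathematicalPhysics.QuantumFieldTheory.Balaban1983to89.Node00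
open Literature.MathematicalPhysics.QuantumFieldTheory.Balaban1983to89.T4Continuum (T4Family)
open Literature.MathematicalPhysics.QuantumFieldTheory.Balaban1983to89.FederbushMean
open Literature.MathematicalPhysics.QuantumFieldTheory.Balaban1983to89.ExpMeanLog (smallFamilies)
open Literature.MathematicalPhysics.QuantumFieldTheory.Balaban1983to89.BlockAveragingTwoLevel (stairHol cVar holTo offsetOf holTo_of_adm)

namespace Summit.QuantumFields.YangMills.BalabanUVNodes.N09GaugeFixingTermContinuousOnAdmissible

/-! ## §1 Federbush's mean is continuous on its guard (`SU(N)`, every arity) -/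

section Federbush

variable {n : Type*} [Fintype n] [DecidableEq n] [Nonempty n] {m : ℕ}

omit [Nonempty n] in
/-- The coordinate maps `U ↦ (U_i : M_N(ℂ))` are continuous. [folklore] -/
theorem continuous_coe_apply_SU (i : Fin (m + 1)) :
    Continuous fun U : Fin (m + 1) → Matrix.specialUnitaryGroup n ℂ => (U i : Matrix n n ℂ) :=
  continuous_subtype_val.comp (continuous_apply i)

omit [Nonempty n] in
/-- **The guard of Federbush's mean is OPEN**: `{U | ∀ i k, ‖U_i U_k* − 1‖ < δ_N}` (finitely many strict inequalities of continuous functions).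
[cite: Balaban1987RG1, (0.5) p.253 (bookkeeping)] -/
theorem isOpen_fedGuard_SU :
    IsOpen {U : Fin (m + 1) → Matrix.specialUnitaryGroup n ℂ | ∀ i k, ‖(U i : Matrix n n ℂ) * star (U k : Matrix n n ℂ) - 1‖ < deltaFed n} := by
  have hq : ∀ i k, Continuous fun U : Fin (m + 1) → Matrix.specialUnitaryGroup n ℂ =>
      (U i : Matrix n n ℂ) * star (U k : Matrix n n ℂ) - 1 :=
    fun i k => ((continuous_coe_apply_SU i).mul (continuous_coe_apply_SU k).star).sub continuous_const
  rw [Set.setOf_forall]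
  refine isOpen_iInter_of_finite fun i => ?_
  rw [Set.setOf_forall]
  exact isOpen_iInter_of_finite fun k => isOpen_lt (hq i k).norm continuous_const

/-- **★ FEDERBUSH'S GROUP MEAN (0.10) IS CONTINUOUS ON ITS GUARD** (`SU(N)`-families of any arity): on `{U | ∀ i k, ‖U_i U_k* − 1‖ < δ_N}` the mean is
`(fedSol (U_j U₀*))* · U₀` with `fedSol` Lipschitz on `(1∕100)`-small families (lit-balaban `continuousOn_fedSol`, `fedM_of_small`, `δ_N ≤ 1∕100`) — the `hcont` step of
lit-balaban's `measurable_fedMSU`, as a theorem. [cite: Balaban1987RG1, (0.10) p.253] -/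
theorem continuousOn_fedMSU :
    ContinuousOn (fedMSU : (Fin (m + 1) → Matrix.specialUnitaryGroup n ℂ) → Matrix.specialUnitaryGroup n ℂ)
      {U | ∀ i k, ‖(U i : Matrix n n ℂ) * star (U k : Matrix n n ℂ) - 1‖ < deltaFed n} := by
  set s : Set (Fin (m + 1) → Matrix.specialUnitaryGroup n ℂ) :=
    {U | ∀ i k, ‖(U i : Matrix n n ℂ) * star (U k : Matrix n n ℂ) - 1‖ < deltaFed n} with hs_def
  have hcoe := continuous_coe_apply_SU (n := n) (m := m)
  have hrel : ContinuousOn (fun U : Fin (m + 1) → Matrix.specialUnitaryGroup n ℂ => rel (fun j => (U j : Matrix n n ℂ)) 0) s :=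
    (continuous_pi fun j => (hcoe j).mul (hcoe 0).star).continuousOn
  have hmaps : Set.MapsTo (fun U : Fin (m + 1) → Matrix.specialUnitaryGroup n ℂ => rel (fun j => (U j : Matrix n n ℂ)) 0) s
      (smallFamilies (Fin (m + 1)) (Matrix n n ℂ) (1 / 100)) :=
    fun U hU j => (hU j 0).trans_le deltaFed_le
  refine Topology.IsInducing.subtypeVal.continuousOn_iff.2 ?_
  have h1 : ContinuousOn (fun U : Fin (m + 1) → Matrix.specialUnitaryGroup n ℂ =>
      star (fedSol (rel (fun j => (U j : Matrix n n ℂ)) 0)) * (U 0 : Matrix n n ℂ)) s :=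
    (continuous_star.comp_continuousOn (continuousOn_fedSol.comp hrel hmaps)).mul (hcoe 0).continuousOn
  refine h1.congr fun U hU => ?_
  show ((fedMSU U : Matrix.specialUnitaryGroup n ℂ) : Matrix n n ℂ) = _
  rw [coe_fedMSU, fedM_of_small hU]

end Federbush

/-! ## §2 The group-average face: `federbushSU.avg` is continuous on the admissible families -/

section Avg

variable {n : Type*} [Fintype n] [DecidableEq n] [Nonempty n] {ι : Type*} [Fintype ι] [Nonempty ι]

omit [Fintype ι] [Nonempty ι] in
/-- **`Adm` IS THE GUARD OF THE ENUMERATED FAMILY** (`dist1 U = ‖U − 1‖` on `SU(N)`, `(U_k⁻¹ : M_N(ℂ)) = U_k*`; `Iff.rfl`). [cite: Balaban1987RG1, (0.5) p.253 (bookkeeping)] -/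
theorem adm_federbushSU_iff (W : ι → Matrix.specialUnitaryGroup n ℂ) :
    (federbushSU (n := n)).Adm W ↔ ∀ i k, ‖(W i : Matrix n n ℂ) * star (W k : Matrix n n ℂ) - 1‖ < deltaFed n := Iff.rfl

omit [Nonempty ι] in
/-- The admissible families form an OPEN set. [cite: Balaban1987RG1, (0.5) p.253 (bookkeeping)] -/
theorem isOpen_setOf_adm_federbushSU : IsOpen {W : ι → Matrix.specialUnitaryGroup n ℂ | (federbushSU (n := n)).Adm W} := by
  have hcoe : ∀ i : ι, Continuous fun W : ι → Matrix.specialUnitaryGroup n ℂ => (W i : Matrix n n ℂ) :=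
    fun i => continuous_subtype_val.comp (continuous_apply i)
  have hq : ∀ i k : ι, Continuous fun W : ι → Matrix.specialUnitaryGroup n ℂ => (W i : Matrix n n ℂ) * star (W k : Matrix n n ℂ) - 1 :=
    fun i k => ((hcoe i).mul (hcoe k).star).sub continuous_const
  simp only [adm_federbushSU_iff, Set.setOf_forall]
  exact isOpen_iInter_of_finite fun i => isOpen_iInter_of_finite fun k => isOpen_lt (hq i k).norm continuous_const

/-- **★ THE GROUP AVERAGE `W ↦ M({W_i})` IS CONTINUOUS ON THE ADMISSIBLE FAMILIES** (`GroupAverage.avg` = the mean of the enumerated family; §1 along the continuous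
re-indexing `W ↦ W ∘ enum⁻¹`). [cite: Balaban1987RG1, (0.10)–(0.11) p.253] -/
theorem continuousOn_avg_federbushSU :
    ContinuousOn (fun W : ι → Matrix.specialUnitaryGroup n ℂ => (federbushSU (n := n)).avg W)
      {W | (federbushSU (n := n)).Adm W} := by
  have hre : Continuous fun W : ι → Matrix.specialUnitaryGroup n ℂ => W ∘ (LoopAverage.enum ι).symm :=
    continuous_pi fun k => continuous_apply _
  have hmaps : Set.MapsTo (fun W : ι → Matrix.specialUnitaryGroup n ℂ => W ∘ (LoopAverage.enum ι).symm)
      {W | (federbushSU (n := n)).Adm W}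
      {U : Fin (Fintype.card ι - 1 + 1) → Matrix.specialUnitaryGroup n ℂ |
        ∀ i k, ‖(U i : Matrix n n ℂ) * star (U k : Matrix n n ℂ) - 1‖ < deltaFed n} :=
    fun W hW i k => hW _ _
  exact continuousOn_fedMSU.comp hre.continuousOn hmaps

end Avg

/-! ## §3 The contour face: the averaged contour variable `U(y,x)` is continuous where its staircase family is admissible -/

section Contour

variable {N : ℕ} [NeZero N] {P : Params} {j : ℕ}

/-- The staircase family `σ ↦ U(Γ^σ_{y, y+n})` is continuous in the configuration (finite products in `SU(N)`; lit-balaban `BlockAveraging.continuous_holAt`).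
[cite: Balaban1987RG1, (0.11) p.253 (bookkeeping)] -/
theorem continuous_stairHol_SU (y : Site P (j + 1)) (n : Fin P.d → ℤ) :
    Continuous fun U : GaugeField P j (SU N) => stairHol U y n :=
  continuous_pi fun _ => BlockAveraging.continuous_holAt _

/-- The configurations whose staircase family at `(y, x)` is admissible form an OPEN set. [cite: Balaban1987RG1, (0.5) and (0.11) p.253 (bookkeeping)] -/
theorem isOpen_setOf_adm_stairHol (y : Site P (j + 1)) (x : Site P j) :
    IsOpen {U : GaugeField P j (SU N) | (federbushSU (n := Fin N)).Adm (stairHol U y (offsetOf y x))} :=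
  isOpen_setOf_adm_federbushSU.preimage (continuous_stairHol_SU y (offsetOf y x))

/-- **★ THE AVERAGED CONTOUR VARIABLE `U(y,x)` OF (0.11) IS CONTINUOUS ON THE ADMISSIBLE SET**: on `{U | Adm (stairHol U y (offsetOf y x))}` the total `holTo` IS Federbush's
mean of the staircase family (`holTo_of_adm`), continuous by §2 ∘ `continuous_stairHol_SU`. [cite: Balaban1987RG1, (0.10)–(0.11) p.253] -/
theorem continuousOn_holTo_federbushSU (y : Site P (j + 1)) (x : Site P j) :
    ContinuousOn (fun U : GaugeField P j (SU N) => holTo (federbushSU (n := Fin N)) U y x)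
      {U | (federbushSU (n := Fin N)).Adm (stairHol U y (offsetOf y x))} := by
  have h : ContinuousOn (fun U : GaugeField P j (SU N) => cVar (federbushSU (n := Fin N)) U y (offsetOf y x))
      {U | (federbushSU (n := Fin N)).Adm (stairHol U y (offsetOf y x))} :=
    continuousOn_avg_federbushSU.comp (continuous_stairHol_SU y (offsetOf y x)).continuousOn fun U hU => hU
  exact h.congr fun U hU => holTo_of_adm _ U y x hU

end Contour

/-! ## §4 At the record: `GF_k` is continuous on the admissible set, hence on every subset — the `hGF` supplier -/

section Record

variable {F : T4Family} {N : ℕ} [NeZero N]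

/-- The ADMISSIBLE SET of step `k` — every staircase family `{U(Γ^σ_{y,x})}_σ`, `x ∈ B(y)`, is `δ_N`-admissible — is OPEN.
[cite: Balaban1987RG1, (0.5) and (0.11) p.253 (bookkeeping)] -/
theorem isOpen_admissibleSet (K k : ℕ) :
    IsOpen {U : GaugeField (F.P K) k (SU N) | ∀ y : Site (F.P K) (k + 1), ∀ x ∈ block y,
      (federbushSU (n := Fin N)).Adm (stairHol U y (offsetOf y x))} := by
  simp only [Set.setOf_forall]
  exact isOpen_iInter_of_finite fun y => isOpen_iInter_of_finite fun x => isOpen_iInter_of_finite fun _ =>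
    isOpen_setOf_adm_stairHol y x

/-- **★★ THE GAUGE-FIXING TERM OF RECORD IS CONTINUOUS ON THE ADMISSIBLE SET**: `GF_k(U) = Σ_y Σ_{x ∈ B(y), x ≠ y} [1 − Re tr U(y,x)]` ([I] (0.19)) is a finite sum of
`1 − Re tr` of averaged contour variables, each continuous where its staircase family is admissible (§3); `Re tr` is continuous.
[cite: Balaban1987RG1, (0.17)–(0.19) p.255 and (0.11) p.253] -/
theorem continuousOn_gfOfRecord_admissible (K k : ℕ) :
    ContinuousOn (gfOfRecord F N K k) {U : GaugeField (F.P K) k (SU N) | ∀ y : Site (F.P K) (k + 1), ∀ x ∈ block y,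
      (federbushSU (n := Fin N)).Adm (stairHol U y (offsetOf y x))} := by
  have hre : Continuous (GaugeGroup.reTr : SU N → ℝ) :=
    UnitaryModel.continuous_nReTr.comp (Literature.MathematicalPhysics.QuantumLattice.continuous_fundamentalRep (Fin N))
  show ContinuousOn (fun U : GaugeField (F.P K) k (SU N) =>
    ∑ y ∈ Finset.univ, ∑ x ∈ (block y).erase (emb y), (1 - GaugeGroup.reTr ((contourOfRecord F N K k).holTo U y x))) _
  refine continuousOn_finsetSum _ fun y _ => continuousOn_finsetSum _ fun x hx => ?_
  have hxB : x ∈ block y := Finset.mem_of_mem_erase hx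
  have hholTo : ContinuousOn (fun U : GaugeField (F.P K) k (SU N) => (contourOfRecord F N K k).holTo U y x)
      {U : GaugeField (F.P K) k (SU N) | ∀ y : Site (F.P K) (k + 1), ∀ x ∈ block y,
        (federbushSU (n := Fin N)).Adm (stairHol U y (offsetOf y x))} :=
    (continuousOn_holTo_federbushSU y x).mono fun U hU => hU y x hxB
  exact continuousOn_const.sub (hre.comp_continuousOn hholTo)

/-- **★★ … HENCE ON EVERY SET OF ADMISSIBLE CONFIGURATIONS** — the `hGF` supplier of this seat's FILES 2–3: `D ⊆ {admissible} → ContinuousOn (gfOfRecord F N K k) D`.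
[cite: Balaban1987RG1, (0.19) p.255 and (0.11) p.253] -/
theorem continuousOn_gfOfRecord_of_subset_admissible (K k : ℕ) {D : Set (GaugeField (F.P K) k (SU N))}
    (hD : D ⊆ {U : GaugeField (F.P K) k (SU N) | ∀ y : Site (F.P K) (k + 1), ∀ x ∈ block y,
      (federbushSU (n := Fin N)).Adm (stairHol U y (offsetOf y x))}) :
    ContinuousOn (gfOfRecord F N K k) D :=
  (continuousOn_gfOfRecord_admissible K k).mono hD

/-- **★★ AT THE SMALL-FIELD DOMAIN OF RECORD**: if every configuration of `domAltOfRecord ν K k` has all its staircase families `δ_N`-admissible (DISPLAYED — the lattice-Stokes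
smallness of staircase pairs inside a block on `ε₀`-small fields, [I] p. 253 «sufficiently small diameters»), then `GF_k` is continuous on `domAltOfRecord ν K k` — the
hypothesis `hGF` of `…N09FibreIntegralContinuousOfChartRegularity` ∕ `…N09RegularityTowerOfChartRegularity` at step `k`. [cite: Balaban1987RG1, (0.19) p.255, (0.11) p.253 and p.259] -/
theorem continuousOn_gfOfRecord_domAlt_of_admissible (ν : Stage7Numerics) (K k : ℕ)
    (hadm : ∀ U ∈ domAltOfRecord F N ν K k, ∀ y : Site (F.P K) (k + 1), ∀ x ∈ block y,
      (federbushSU (n := Fin N)).Adm (stairHol U y (offsetOf y x))) :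
    ContinuousOn (gfOfRecord F N K k) (domAltOfRecord F N ν K k) :=
  continuousOn_gfOfRecord_of_subset_admissible K k fun U hU => hadm U hU

end Record

/-! ## §5 The geometric inclusion: on `ε₀`-small fields every staircase family is admissible (lattice Stokes for staircase PAIRS) -/

section Stokes

open Literature.MathematicalPhysics.QuantumFieldTheory.Balaban1983to89.T4Continuum (Letter netDisp walk holAt wordRev stairWord netDisp_wordRev netDisp_stairWord
  walk_append holAt_append holAt_walk_wordRev)
open Literature.MathematicalPhysics.QuantumFieldTheory.Balaban1983to89.BlockAveraging (off off_bounds)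
open Literature.MathematicalPhysics.QuantumFieldTheory.Balaban1983to89.LatticeWordStokes (dist1_holAt_le length_stairWord_le)

variable {P : Params} {j : ℕ} {G : Type*} [GaugeGroup G]

/-- A reversed word has the same length. [folklore] -/
private theorem length_wordRev' {d : ℕ} (w : List (Letter d)) : (wordRev w).length = w.length := by
  simp [wordRev]

/-- **THE QUOTIENT OF TWO STAIRCASE TRANSPORTERS IS THE HOLONOMY OF A CLOSED WORD**: `U(Γ^σ)·U(Γ^τ)⁻¹ = 𝒰_{emb y}(Γ^σ · (Γ^τ)^{rev})` (both staircases run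
from `emb y` to `emb y + n`; `holAt_walk_wordRev`, `walk_append`, `holAt_append`). [cite: Balaban1987RG1, (0.3) p.252 and (0.5) p.253 (bookkeeping)] -/
theorem stairHol_mul_inv_eq_holAt (U : GaugeField P j G) (y : Site P (j + 1)) (n : Fin P.d → ℤ) (σ τ : Equiv.Perm (Fin P.d)) :
    stairHol U y n σ * (stairHol U y n τ)⁻¹ = holAt U (walk (emb y) (stairWord σ n ++ wordRev (stairWord τ n))) := by
  unfold stairHol
  rw [← holAt_walk_wordRev, walk_append, holAt_append, T4Continuum.walkEnd_stairWord, T4Continuum.walkEnd_stairWord]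

/-- The closed word `Γ^σ · (Γ^τ)^{rev}` has zero net displacement. [folklore] -/
theorem netDisp_stairWord_append_wordRev (σ τ : Equiv.Perm (Fin P.d)) (n : Fin P.d → ℤ) (κ : Fin P.d) :
    netDisp (stairWord σ n ++ wordRev (stairWord τ n)) κ = 0 := by
  rw [T4ReflectionCone.netDisp_append, netDisp_wordRev, netDisp_stairWord, netDisp_stairWord, add_neg_cancel]

/-- … and length at most `2·d·N` when all `|n_ν| ≤ N`. [cite: Balaban1987RG1, (0.3) p.252 (bookkeeping)] -/
theorem length_stairWord_append_wordRev_le (σ τ : Equiv.Perm (Fin P.d)) (n : Fin P.d → ℤ) (M : ℕ) (hn : ∀ ν, (n ν).natAbs ≤ M) :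
    (stairWord σ n ++ wordRev (stairWord τ n)).length ≤ 2 * (P.d * M) := by
  rw [List.length_append, length_wordRev']
  have h1 := length_stairWord_le σ n M hn
  have h2 := length_stairWord_le τ n M hn
  omega

/-- **★ LATTICE STOKES FOR STAIRCASE PAIRS**: on a configuration with all plaquette variables within `a ≥ 0` of `1`, for `x = blockSite y r ∈ B(y)` and any two orderings,
`|U(Γ^σ_{y,x})·U(Γ^τ_{y,x})⁻¹ − 1| ≤ ((d·L)²∕4)·a` (the crude closed-word bound `dist1_holAt_le`: `(|w|²∕4)·a` with `|w| ≤ 2·d·(L−1)∕2 ≤ d·L`).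
[cite: Balaban1985Averaging, (19)–(20) p.21; Balaban1987RG1, (0.3) p.252 and (0.5) p.253] -/
theorem dist1_stairHol_mul_inv_le {a : ℝ} (ha : 0 ≤ a) {U : GaugeField P j G} (hU : PlaqSmall a U) (y : Site P (j + 1)) (r : Fin P.d → Fin P.L)
    (σ τ : Equiv.Perm (Fin P.d)) :
    dist1 (stairHol U y (off r) σ * (stairHol U y (off r) τ)⁻¹) ≤ ((((P.d * P.L : ℕ) : ℝ)) ^ 2 / 4) * a := by
  rw [stairHol_mul_inv_eq_holAt]
  have hn : ∀ κ, (off r κ).natAbs ≤ (P.L - 1) / 2 := fun κ => by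
    have h := off_bounds r κ
    omega
  have h := dist1_holAt_le U ha hU _ (netDisp_stairWord_append_wordRev σ τ (off r)) (emb y)
  refine h.trans (mul_le_mul_of_nonneg_right ?_ ha)
  have hlen : ((stairWord σ (off r) ++ wordRev (stairWord τ (off r))).length : ℝ) ≤ ((P.d * P.L : ℕ) : ℝ) := by
    have h1 := length_stairWord_append_wordRev_le (P := P) σ τ (off r) _ hn
    have h2 : 2 * (P.d * ((P.L - 1) / 2)) ≤ P.d * P.L := by
      have : 2 * ((P.L - 1) / 2) ≤ P.L := by omega
      nlinarith
    exact_mod_cast h1.trans h2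
  have h0 : (0 : ℝ) ≤ ((stairWord σ (off r) ++ wordRev (stairWord τ (off r))).length : ℝ) := Nat.cast_nonneg _
  nlinarith

end Stokes

section SmallField

variable {F : T4Family} {N : ℕ} [NeZero N]

/-- Every site of `B(y)` is a `blockSite y r` (standing range; `Site.blockEquiv`). [folklore] -/
private theorem exists_blockSite_eq {P : Params} {j : ℕ} (hj : j + 1 ≤ P.m + P.K) {y : Site P (j + 1)} {x : Site P j} (hx : x ∈ block y) :
    ∃ r : Fin P.d → Fin P.L, Site.blockSite y r = x := by
  have hx' : blockOf x = y := (Finset.mem_filter.1 hx).2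
  exact ⟨Site.blockEquiv hj y ⟨x, hx'⟩, congrArg Subtype.val ((Site.blockEquiv hj y).left_inv ⟨x, hx'⟩)⟩

/-- **★★ ON `a`-SMALL FIELDS EVERY STAIRCASE FAMILY IS `δ_N`-ADMISSIBLE** once `((d·L)²∕4)·a < δ_N` ([I] p. 253 «defined on sets … with sufficiently small diameters» —
the Federbush guard is INACTIVE on small fields, as `LatticeWordStokes.small_of_plaqSmall` is for the (0.4) guard). [cite: Balaban1987RG1, (0.5) and (0.11) p.253] -/
theorem adm_stairHol_of_plaqSmall {K k : ℕ} (hk : k + 1 ≤ (F.P K).m + (F.P K).K) {a : ℝ} (ha : 0 ≤ a) {U : GaugeField (F.P K) k (SU N)}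
    (hU : PlaqSmall a U) (hnum : ((((F.P K).d * (F.P K).L : ℕ) : ℝ)) ^ 2 / 4 * a < deltaFed (Fin N))
    (y : Site (F.P K) (k + 1)) {x : Site (F.P K) k} (hx : x ∈ block y) :
    (federbushSU (n := Fin N)).Adm (stairHol U y (offsetOf y x)) := by
  obtain ⟨r, hr⟩ := exists_blockSite_eq hk hx
  subst hr
  intro σ τ
  have h := dist1_stairHol_mul_inv_le ha hU y r σ τ
  rw [← BlockAveragingTwoLevel.offsetOf_blockSite hk y r] at h
  exact h.trans_lt hnum

/-- **★★★ `hGF` DISCHARGED MODULO NUMERICS: THE GAUGE-FIXING TERM OF RECORD IS CONTINUOUS ON THE SMALL-FIELD DOMAIN** `domAltOfRecord ν K k` (`= {PlaqSmall ν.ε₀}`) whenever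
`0 ≤ ν.ε₀` and `((d·L)²∕4)·ν.ε₀ < δ_N` (standing range `k + 1 ≤ m + K`): §4's continuity on the admissible set + §5's inclusion.  This is the hypothesis `hGF` of
`…N09FibreIntegralContinuousOfChartRegularity` ∕ `…N09RegularityTowerOfChartRegularity` at step `k`, now a theorem of the numerics. [cite: Balaban1987RG1, (0.19) p.255, (0.11) p.253 and p.259] -/
theorem continuousOn_gfOfRecord_domAlt (ν : Stage7Numerics) {K k : ℕ} (hk : k + 1 ≤ (F.P K).m + (F.P K).K) (hε : 0 ≤ ν.ε₀)
    (hnum : ((((F.P K).d * (F.P K).L : ℕ) : ℝ)) ^ 2 / 4 * ν.ε₀ < deltaFed (Fin N)) :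
    ContinuousOn (gfOfRecord F N K k) (domAltOfRecord F N ν K k) :=
  continuousOn_gfOfRecord_domAlt_of_admissible ν K k fun U hU y _ hx =>
    adm_stairHol_of_plaqSmall hk hε ((mem_domAltOfRecord_iff F N ν K k U).1 hU) hnum y hx

end SmallField

end Summit.QuantumFields.YangMills.BalabanUVNodes.N09GaugeFixingTermContinuousOnAdmissible

end
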